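import Summits.CriticalPhenomena.PercolationContinuityZ3.Theses.PercNonProliferation
import Literature.Probability.Percolation.MinOpenCutMenger

/-!
# Crux-ideate sketch, ideator 2 (round 1): crux `NonProliferation` (stmt-CriticalPhenomena-4444)

First lemmas and transfer targets of the two idea cards filed by this seat:

* card `supercritical-cut-descent` — `cutLE`, `firstLemma_cut_subset`, `firstLemma_descent`,
  `SupercriticalCutTightness`, `nonProliferation_of_supercriticalCutTightness`;
* card `birth-merge-ledger` — `creates`, `mergesAt`, `birthRate`, `mergeRate`,
  `firstLemma_ledger_deriv`, `firstLemma_screening`, `logLedger`, `BirthBudget`,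
  `nonProliferation_of_birthBudget`.

Everything is stated over existing declarations; `sorry` marks statements, not claims of proof.
-/

open Literature.Probability.LatticeModels Literature.Probability.Percolation MeasureTheory
open scoped Classical

noncomputable section

namespace Summit.CriticalPhenomena.PercolationContinuityZ3.Cruxes.NonProliferation.Ideator2

/-- bond percolation on `ℤ³` at parameter `p` -/
abbrev μ (p : unitInterval) : Measure (BondConfig (Site 3)) := bondPercolation (zdGraph 3) p

/-- the same at a real parameter, clamped to `[0,1]` (the shape used by `russo_formula`) -/
abbrev μr (t : ℝ) : Measure (BondConfig (Site 3)) := μ (Set.projIcc (0 : ℝ) 1 zero_le_one t)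

/-- the free box `B(2n)` as a set -/
def B2 (n : ℕ) : Set (Site 3) := ↑(box 3 (2 * n))

/-- the inner vertex boundary `∂⁻B(2n)` as a set -/
def Outer (n : ℕ) : Set (Site 3) := ↑(innerBoundary (zdGraph 3) (box 3 (2 * n)))

/-- the crux's encoding of `N_n ≥ k+1`: `k+1` pairwise-unjoined spanning representatives -/
def reps (k n : ℕ) : Set (BondConfig (Site 3)) :=
  {ω | ∃ x : Fin (k + 1) → Site 3, (∀ i, x i ∈ box 3 n) ∧
    (∀ i, ∃ y ∈ innerBoundary (zdGraph 3) (box 3 (2 * n)), ω ∈ openConnIn ↑(box 3 (2 * n)) (x i) y) ∧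
    ∀ i j, i ≠ j → ω ∉ openConnIn ↑(box 3 (2 * n)) (x i) (x j)}

/-- the annulus-crossing event `{B(n) ↔ ∂⁻B(2n) in B(2n)}`, probability `u_n(p)` -/
def cross (n : ℕ) : Set (BondConfig (Site 3)) :=
  {ω | ∃ x ∈ box 3 n, ∃ y ∈ innerBoundary (zdGraph 3) (box 3 (2 * n)), ω ∈ openConnIn ↑(box 3 (2 * n)) x y}

/-- `E_p[N_n] = Σ_k P_p(N_n ≥ k+1)` (the shape of `MeanCauchySchwarz`) -/
def meanN (p : unitInterval) (n : ℕ) : ℝ := ∑ k ∈ Finset.range (box 3 n).card, (μ p).real (reps k n)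

/-! ## Card A — supercritical cut descent -/

/-- `{F_n ≤ M}`: the open sub-network of `B(2n)` has an `(B(n), ∂⁻B(2n))` cut with at most `M`
open edges (equivalently, by `maxDisjointOpenPathsIn_eq_minOpenCutIn`, at most `M` pairwise
edge-disjoint open crossings). A DECREASING event. -/
def cutLE (n M : ℕ) : Set (BondConfig (Site 3)) :=
  {ω | minOpenCutIn (B2 n) ↑(box 3 n) (Outer n) ω ≤ M}

/-- First lemma A1: `M+1` distinct spanning box-clusters carry `M+1` vertex-disjoint, hence
edge-disjoint, open crossings, so a cut of size `≤ M` forbids them (`N_n ≤ F_n`). -/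
theorem firstLemma_cut_subset (n M : ℕ) : cutLE n M ⊆ (reps M n)ᶜ := by
  sorry

/-- First lemma A2 (monotone descent): `{F_n ≤ M}` is decreasing, so the critical probability
dominates every supercritical one (monotone coupling, `real_mono_of_isUpperSet` on the complement). -/
theorem firstLemma_descent (n M : ℕ) (q : unitInterval) (hq : criticalProbI 3 ≤ q) :
    (μ q).real (cutLE n M) ≤ (μ (criticalProbI 3)).real (cutLE n M) := by
  sorry

/-- Transfer A — `SupercriticalCutTightness` (C⁺): min-cut tightness with fixed `(M, c)` is
achieved AT supercritical parameters, at scales that diverge as `q ↓ p_c` (the intended witness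
scale is the flow length `φ(q)^{-1/2}`, which diverges by Zhang 2000 + continuity of the flow
constant). -/
def SupercriticalCutTightness : Prop :=
  ∃ (M : ℕ) (c : ℝ), 0 < c ∧ ∀ n₀ : ℕ, ∃ δ : ℝ, 0 < δ ∧ ∀ q : unitInterval,
    criticalProbI 3 < q → (q : ℝ) < criticalProbI 3 + δ → ∃ n, n₀ ≤ n ∧ c ≤ (μ q).real (cutLE n M)

/-- The reduction (A1 + A2 + bookkeeping on `∃ᶠ`). -/
theorem nonProliferation_of_supercriticalCutTightness (hpc : (criticalProbI 3 : ℝ) < 1) :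
    SupercriticalCutTightness → Theses.PercNonProliferation.NonProliferation := by
  sorry

/-! ## Card B — birth/merge ledger -/

/-- creation configuration at the ORDERED lattice edge `(x, y)`, read on `ω` with that edge
removed: the box-cluster of `x` meets `B(n)` but not `∂⁻B(2n)`, that of `y` meets `∂⁻B(2n)` but
not `B(n)`, and the two are distinct. Opening the edge raises `N_n` by one. -/
def creates (n : ℕ) (x y : Site 3) : Set (BondConfig (Site 3)) :=
  {ω | (ω \ {s(x, y)}) ∉ openConnIn (B2 n) x y ∧
    (∃ a ∈ box 3 n, (ω \ {s(x, y)}) ∈ openConnIn (B2 n) x a) ∧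
    (∀ b ∈ Outer n, (ω \ {s(x, y)}) ∉ openConnIn (B2 n) x b) ∧
    (∃ b ∈ Outer n, (ω \ {s(x, y)}) ∈ openConnIn (B2 n) y b) ∧
    (∀ a ∈ box 3 n, (ω \ {s(x, y)}) ∉ openConnIn (B2 n) y a)}

/-- merge configuration at `(x, y)`: distinct box-clusters off the edge, both spanning.
Opening the edge lowers `N_n` by one. Symmetric in `(x, y)`. -/
def mergesAt (n : ℕ) (x y : Site 3) : Set (BondConfig (Site 3)) :=
  {ω | (ω \ {s(x, y)}) ∉ openConnIn (B2 n) x y ∧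
    (∃ a ∈ box 3 n, (ω \ {s(x, y)}) ∈ openConnIn (B2 n) x a) ∧
    (∃ b ∈ Outer n, (ω \ {s(x, y)}) ∈ openConnIn (B2 n) x b) ∧
    (∃ a ∈ box 3 n, (ω \ {s(x, y)}) ∈ openConnIn (B2 n) y a) ∧
    (∃ b ∈ Outer n, (ω \ {s(x, y)}) ∈ openConnIn (B2 n) y b)}

/-- ordered nearest-neighbour pairs of `B(2n)` -/
def edgePairs (n : ℕ) : Finset (Site 3 × Site 3) :=
  ((box 3 (2 * n)) ×ˢ (box 3 (2 * n))).filter fun q => (zdGraph 3).Adj q.1 q.2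

/-- birth rate `Σ_e P_t(Cr_e)` (each unordered edge contributes its two orientations, which are
disjoint events) -/
def birthRate (t : ℝ) (n : ℕ) : ℝ := ∑ q ∈ edgePairs n, (μr t).real (creates n q.1 q.2)

/-- merge rate `Σ_e P_t(Mg_e)` (ordered pairs double-count the symmetric event) -/
def mergeRate (t : ℝ) (n : ℕ) : ℝ := (∑ q ∈ edgePairs n, (μr t).real (mergesAt n q.1 q.2)) / 2

/-- First lemma B1 (Russo for the non-monotone integer count `N_n`):
`d/dt E_t[N_n] = births − merges`. -/
theorem firstLemma_ledger_deriv (n : ℕ) {t : ℝ} (ht : t ∈ Set.Ioo (0 : ℝ) 1) :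
    HasDerivAt (fun s => meanN (Set.projIcc (0 : ℝ) 1 zero_le_one s) n)
      (birthRate t n - mergeRate t n) t := by
  sorry

/-- First lemma B2 (exploration/screening inequality): conditionally on the two pieces of a
creation configuration the rest of `B(2n)` is fresh, and "no other spanning cluster" there is at
least as likely as "no spanning cluster at all"; with Russo for `cross n` this reads
`(1 − u_n(t)) · births(t) ≤ u_n'(t)`. -/
theorem firstLemma_screening (n : ℕ) {t : ℝ} (ht : t ∈ Set.Ioo (0 : ℝ) 1) :
    (1 - (μr t).real (cross n)) * birthRate t n ≤ deriv (fun s => (μr s).real (cross n)) t := by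
  sorry

/-- Consequence (log-ledger bound, every `p < 1`, every `n`): `E_p[N_n] ≤ log (1 / P_p(B(n) ↮ ∂⁻B(2n)))`
— an exponential sharpening of the BK cap `u/(1−u)` (`SpanningBKCap`). The same bound holds for
`E_p[N_n] + E[#merges on [0,p]]`. -/
theorem logLedger (n : ℕ) (hn : 1 ≤ n) (p : unitInterval) (hp : (p : ℝ) < 1) :
    meanN p n ≤ Real.log (1 / (1 - (μ p).real (cross n))) := by
  sorry

/-- Transfer B — `BirthBudget` (C⁺): the births integrated over `[0, p_c]` stay bounded along a
subsequence. Equivalent to (mean-form crux) ∧ (bounded merge count); an integral over the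
sub-critical window of LOCAL two-arm site densities, with no cluster counting at `p_c`. -/
def BirthBudget : Prop :=
  ∃ C : ℝ, ∃ᶠ n : ℕ in Filter.atTop, ∫ t in (0 : ℝ)..(criticalProbI 3 : ℝ), birthRate t n ≤ C

/-- The reduction: `E_{p_c}[N_n] ≤ ∫ births ≤ C`, then Markov with `M + 1 > 2C`. -/
theorem nonProliferation_of_birthBudget (hpc : (criticalProbI 3 : ℝ) < 1) :
    BirthBudget → Theses.PercNonProliferation.NonProliferation := by
  sorry

end Summit.CriticalPhenomena.PercolationContinuityZ3.Cruxes.NonProliferation.Ideator2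

end
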